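import Literature.NumberTheory.EllipticCurves.GaloisAction
import Literature.NumberTheory.EllipticCurves.Isogeny
import HarnessLib

/-!
# Serre's open image theorem and Mazur's isogeny theorem (mod-`p` Galois images of `E/ℚ`)

Topic `Literature/NumberTheory/EllipticCurves` (fact item `wi-03672`, route
`BirchSwinnertonDyer/SelmerRank`, cruxes #2–#4: choosing a prime `p` with large image).

Two named facts (statements, D-0014) about the mod-`p` Galois representations
`ρ̄_{E,p} : Γ_ℚ → Aut(E[p]) ≅ GL₂(𝔽_p)` of an elliptic curve `E/ℚ`, phrased with the library's
predicates `WeierstrassCurve.HasSurjectiveModNGaloisRep`, `HasIrreducibleModPGaloisRep`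
(`GaloisAction.lean`) and `WeierstrassCurve.HasCM` (geometric CM, `Isogeny.lean`):

* `serre_open_image` — **Serre 1972, §4.2, Théorème 2**: if `E/ℚ` has no complex multiplication
  then `ρ̄_{E,p}` is surjective for all sufficiently large primes `p`.
* `mazur_isogeny_irreducible` — **Mazur 1978, Theorem 1** (rational isogenies of prime degree):
  for *every* `E/ℚ` and every prime `p ∉ {2, 3, 5, 7, 11, 13, 17, 19, 37, 43, 67, 163}` the curve
  has no rational `p`-isogeny, i.e. `ρ̄_{E,p}` is irreducible.
* API (real proofs): `mazurPrimes` and its membership facts, and the combination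
  `exists_prime_surjective_irreducible` (a non-CM curve has a prime — indeed all large ones —
  with surjective, in particular irreducible, mod-`p` image), taking the two facts as hypotheses.

## Design notes

* Curves are `WeierstrassCurve ℚ` with `[W.IsElliptic]`, as everywhere in the topic; "no CM" is
  `¬ W.HasCM` (geometric endomorphism ring `= ℤ`).
* Serre's theorem is vendored in its qualitative form (`∃ p₀, ∀ p ≥ p₀`); the uniform bound
  (Serre's uniformity question, `p > 37`) is *not* asserted.
* Mazur's theorem is vendored as irreducibility (equivalent to the absence of a rational
  `p`-isogeny: a `Γ_ℚ`-stable line in `E[p]` is the kernel of one), which is what the route uses.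
* Mathlib: nothing on Galois images of elliptic curves; the predicates are the library's.

## References

* J.-P. Serre, *Propriétés galoisiennes des points d'ordre fini des courbes elliptiques*, Invent.
  Math. 15 (1972) 259–331, §4.2, Théorème 2.
* B. Mazur, *Rational isogenies of prime degree*, Invent. Math. 44 (1978) 129–162, Theorem 1.
-/

noncomputable section

namespace Literature.NumberTheory.EllipticCurves

open WeierstrassCurve

/-- The twelve **Mazur primes** `{2, 3, 5, 7, 11, 13, 17, 19, 37, 43, 67, 163}`: exactly the primes
`p` for which some elliptic curve over `ℚ` admits a rational `p`-isogeny (Mazur 1978, Thm 1).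
[cite: Mazur1978, Thm 1] -/
def mazurPrimes : Finset ℕ :=
  {2, 3, 5, 7, 11, 13, 17, 19, 37, 43, 67, 163}

/-- `163` is the largest Mazur prime. [cite: Mazur1978, Thm 1] -/
theorem le_of_mem_mazurPrimes {p : ℕ} (hp : p ∈ mazurPrimes) : p ≤ 163 := by
  simp only [mazurPrimes, Finset.mem_insert, Finset.mem_singleton] at hp
  omega

/-- Every prime `> 163` lies outside Mazur's list. [cite: Mazur1978, Thm 1] -/
theorem not_mem_mazurPrimes_of_lt {p : ℕ} (hp : 163 < p) : p ∉ mazurPrimes :=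
  fun h => absurd (le_of_mem_mazurPrimes h) (not_le.2 hp)

/-- **Serre's open image theorem, mod-`p` form** (Serre 1972, §4.2, Théorème 2). If the elliptic
curve `E/ℚ` has no (geometric) complex multiplication, then for all sufficiently large primes `p`
the mod-`p` Galois representation `ρ̄_{E,p} : Γ_ℚ → Aut(E[p]) ≅ GL₂(𝔽_p)` is surjective.
[cite: Serre1972, §4.2 Théorème 2] -/
def serre_open_image : Prop :=
  ∀ (W : WeierstrassCurve ℚ) [W.IsElliptic], ¬ W.HasCM →
    ∃ p₀ : ℕ, ∀ p : ℕ, p.Prime → p₀ ≤ p → W.HasSurjectiveModNGaloisRep p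

/-- **Mazur's theorem on rational isogenies of prime degree** (Mazur 1978, Theorem 1), in the form
used for Galois images: for every elliptic curve `E/ℚ` and every prime `p` outside
`{2, 3, 5, 7, 11, 13, 17, 19, 37, 43, 67, 163}`, `E` has no `ℚ`-rational `p`-isogeny, i.e. the mod-`p`
representation `ρ̄_{E,p}` is irreducible (no `Γ_ℚ`-stable subgroup of `E[p]` other than `0` and
`E[p]`). No CM hypothesis. [cite: Mazur1978, Thm 1] -/
def mazur_isogeny_irreducible : Prop :=
  ∀ (W : WeierstrassCurve ℚ) [W.IsElliptic] (p : ℕ), p.Prime → p ∉ mazurPrimes →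
    W.HasIrreducibleModPGaloisRep p

/-! ### Combination used by the Selmer-rank route -/

/-- For a non-CM curve there is a threshold beyond which every prime has surjective mod-`p` image
**and** lies outside Mazur's list (so is also covered by `mazur_isogeny_irreducible`): take
`max p₀ 164`. Real proof from the two facts as hypotheses. [cite: Serre1972, §4.2 Théorème 2] -/
theorem exists_forall_prime_surjective (hS : serre_open_image) (W : WeierstrassCurve ℚ)
    [W.IsElliptic] (hW : ¬ W.HasCM) :
    ∃ p₁ : ℕ, ∀ p : ℕ, p.Prime → p₁ ≤ p → W.HasSurjectiveModNGaloisRep p ∧ p ∉ mazurPrimes := by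
  obtain ⟨p₀, h⟩ := hS W hW
  refine ⟨max p₀ 164, fun p hp hle => ⟨h p hp ((le_max_left _ _).trans hle), ?_⟩⟩
  exact not_mem_mazurPrimes_of_lt (by omega)

/-- In particular a non-CM `E/ℚ` has *some* prime `p` (any prime `≥ max p₀ 164`, e.g. by
`Nat.exists_infinite_primes`) with surjective mod-`p` image and irreducible mod-`p` representation.
[cite: Serre1972, §4.2 Théorème 2] -/
theorem exists_prime_surjective_irreducible (hS : serre_open_image) (hM : mazur_isogeny_irreducible)
    (W : WeierstrassCurve ℚ) [W.IsElliptic] (hW : ¬ W.HasCM) :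
    ∃ p : ℕ, p.Prime ∧ W.HasSurjectiveModNGaloisRep p ∧ W.HasIrreducibleModPGaloisRep p := by
  obtain ⟨p₁, h⟩ := exists_forall_prime_surjective hS W hW
  obtain ⟨p, hle, hp⟩ := Nat.exists_infinite_primes p₁
  obtain ⟨hsurj, hnot⟩ := h p hp hle
  exact ⟨p, hp, hsurj, hM W p hp hnot⟩

end Literature.NumberTheory.EllipticCurves

end
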